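import Literature.MathematicalPhysics.QuantumFieldTheory.TransferTruncatedSchwarzBound
import HarnessLib

/-!
# Per-vector decay upgrade for a positive transfer operator: log-convexity of `n ↦ ⟪v, Tⁿ v⟫`

Companion of `Literature.Probability.LatticeModels.TransferOperator` (`TransferData`: a positive contraction `T`
with a unit vacuum `Ω`, `T Ω = Ω`; `IsOSRealisation`), of `LatticeMassGapProofs` (iterated Schwarz inequality,
clustering on a DENSE set ⇒ spectral gap) and of `TransferTruncatedSchwarzBound` (the gap-free truncated
Cauchy–Schwarz bound).  Here we record the elementary PER-VECTOR facts behind the spectral reading "eventual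
exponential decay of a diagonal correlator `⟪v, Tⁿ v⟫` pins the spectral measure of `v` below the rate" — without a
spectral theorem and without any density hypothesis (Glimm–Jaffe 1987 §6.1, Thm. 6.1.3 (ii)–(iii): `Tⁿ ≥ 0` and the
Schwarz inequality for the form `⟪·, Tⁿ ·⟫`; Osterwalder–Seiler 1978 §2; Seiler LNP 159 Ch. 2):

* `TransferData.re_inner_pow_succ_sq_le` — **log-convexity**: `⟪v, T^{n+1} v⟫² ≤ ⟪v, Tⁿ v⟫ · ⟪v, T^{n+2} v⟫`;
* `TransferData.re_inner_pow_succ_le_mul_of_eventually` — **the decay upgrade**: if `⟪v, Tⁿ v⟫ ≤ K rⁿ` holds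
  EVENTUALLY, with ANY constant `K` (`0 < r`), then `⟪v, T^{n+1} v⟫ ≤ r ⟪v, Tⁿ v⟫` for EVERY `n`; hence
  `⟪v, Tⁿ v⟫ ≤ ⟪v, T^{n₀} v⟫ r^{n−n₀}` for all `n ≥ n₀` (`re_inner_pow_le_mul_pow_of_eventually`) and
  `⟪v, Tⁿ v⟫ ≤ ‖v‖² rⁿ` from `n = 0` on (`re_inner_pow_le_norm_sq_mul_pow_of_eventually`): the constant and the
  threshold of an eventual bound are irrelevant, only its RATE survives, and the honest constant is the value of the
  correlator at the chosen starting time;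
* the same for CONNECTED (vacuum-truncated) diagonal correlators `re ⟪v, Tⁿ v⟫ − |⟪Ω, v⟫|²`, with hypotheses in
  the norm form `‖⟪v, Tⁿ v⟫ − ⟪v, Ω⟫⟪Ω, v⟫‖ ≤ K rⁿ` in which clustering statements are usually given
  (`re_inner_pow_sub_succ_le_mul_of_eventually`, `…_le_mul_pow_…`, `norm_pow_proj_le_of_eventually`);
* `TransferData.norm_inner_pow_sub_le_of_eventually` — **full-rate mixed clustering from two eventual diagonal
  bounds**: `‖⟪u, Tⁿ v⟫ − ⟪u, Ω⟫⟪Ω, v⟫‖ ≤ √(conn_u(2a₀)) · √(conn_v(2b₀)) · r^{n−(a₀+b₀)}` for `n ≥ a₀ + b₀`, and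
  from zero with the truncated norms `√(‖u‖² − |⟪Ω,u⟫|²) √(‖v‖² − |⟪Ω,v⟫|²) rⁿ`;
* the Osterwalder–Schrader measure forms (`IsOSRealisation.…_of_eventually`): for a reflection-positive measure,
  per-observable eventual exponential clustering of the DIAGONAL reflected correlators, with observable-dependent
  constants and thresholds, upgrades to clustering of every mixed reflected correlator from time `0` (resp. from any
  pair of starting times) with the canonical constants — the truncated reflected norms (resp. the diagonal connected
  correlators at the starting times).

Use.  Clustering hypotheses "per pair of observables, each with its own constant `C_{A,B}` and threshold" (the
tree's `QCDScheme.HasLatticeMassGap`, `HasTimeClustering`) say nothing uniform about families of observables whose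
normalisation varies (e.g. lattice fields carrying divergent multiplicative renormalisations); under reflection
positivity the present upgrade replaces `C_{A,A}` by the diagonal correlator of `A` at a fixed positive time, a
quantity that uniform reflected pair bounds control. [cite: GlimmJaffe1987, §6.1 Thm. 6.1.3]
[cite: OsterwalderSeiler1978, §2] [cite: Seiler1982, Ch. 2]
-/

open scoped InnerProductSpace ComplexConjugate
open MeasureTheory Filter

namespace Literature.MathematicalPhysics.QuantumFieldTheory

open Literature.Probability.LatticeModels

section Transfer

variable {H : Type*} [NormedAddCommGroup H] [InnerProductSpace ℂ H] [CompleteSpace H]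

omit [CompleteSpace H] in
/-- Diagonal matrix elements of the powers of the transfer operator are non-negative: `0 ≤ re ⟪v, Tⁿ v⟫`
(`Tⁿ ≥ 0`). [cite: GlimmJaffe1987, §6.1 Thm. 6.1.3 (ii)] -/
theorem _root_.Literature.Probability.LatticeModels.TransferData.re_inner_pow_nonneg (D : TransferData H)
    (v : H) (n : ℕ) : 0 ≤ RCLike.re ⟪v, (D.T ^ n) v⟫_ℂ := by
  rw [← D.inner_pow_apply_left]
  exact (D.isPositive_pow n).re_inner_nonneg_left v

omit [CompleteSpace H] in
/-- `‖Tᵃ v‖² = re ⟪v, T^{2a} v⟫` (symmetry of `Tᵃ`). [cite: GlimmJaffe1987, §6.1 Thm. 6.1.3 (ii)] -/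
theorem _root_.Literature.Probability.LatticeModels.TransferData.norm_pow_apply_sq (D : TransferData H)
    (v : H) (a : ℕ) : ‖(D.T ^ a) v‖ ^ 2 = RCLike.re ⟪v, (D.T ^ (2 * a)) v⟫_ℂ := by
  rw [two_mul, pow_add, mul_apply_eq_comp, ← D.inner_pow_apply_left, inner_self_eq_norm_sq]

omit [CompleteSpace H] in
/-- **Log-convexity of `n ↦ ⟪v, Tⁿ v⟫`** for a positive transfer operator:
`(re ⟪v, T^{n+1} v⟫)² ≤ re ⟪v, Tⁿ v⟫ · re ⟪v, T^{n+2} v⟫` — the Schwarz inequality for the non-negative form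
`⟪Tⁿ ·, ·⟫` at the vectors `v` and `T v`. [cite: GlimmJaffe1987, §6.1 Thm. 6.1.3 (ii)–(iii)] -/
theorem _root_.Literature.Probability.LatticeModels.TransferData.re_inner_pow_succ_sq_le (D : TransferData H)
    (v : H) (n : ℕ) :
    RCLike.re ⟪v, (D.T ^ (n + 1)) v⟫_ℂ ^ 2 ≤
      RCLike.re ⟪v, (D.T ^ n) v⟫_ℂ * RCLike.re ⟪v, (D.T ^ (n + 2)) v⟫_ℂ := by
  have hcs := (D.isPositive_pow n).norm_inner_sq_le v (D.T v)
  have h1 : ⟪(D.T ^ n) v, D.T v⟫_ℂ = ⟪v, (D.T ^ (n + 1)) v⟫_ℂ := by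
    rw [D.inner_pow_apply_left, pow_succ, mul_apply_eq_comp]
  have h2 : ⟪(D.T ^ n) v, v⟫_ℂ = ⟪v, (D.T ^ n) v⟫_ℂ := D.inner_pow_apply_left n v v
  have h3 : ⟪(D.T ^ n) (D.T v), D.T v⟫_ℂ = ⟪v, (D.T ^ (n + 2)) v⟫_ℂ := by
    have hv : (D.T ^ (n + 2)) v = D.T ((D.T ^ n) (D.T v)) := by
      rw [pow_succ', pow_succ, mul_apply_eq_comp, mul_apply_eq_comp]
    rw [hv, D.inner_pow_apply_left, D.isPositive.inner_left_eq_inner_right]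
  have hre : RCLike.re ⟪v, (D.T ^ (n + 1)) v⟫_ℂ ^ 2 ≤ ‖⟪v, (D.T ^ (n + 1)) v⟫_ℂ‖ ^ 2 := by
    have h := RCLike.abs_re_le_norm ⟪v, (D.T ^ (n + 1)) v⟫_ℂ
    rw [← sq_abs]
    exact pow_le_pow_left₀ (abs_nonneg _) h 2
  calc RCLike.re ⟪v, (D.T ^ (n + 1)) v⟫_ℂ ^ 2 ≤ ‖⟪v, (D.T ^ (n + 1)) v⟫_ℂ‖ ^ 2 := hre
    _ = ‖⟪(D.T ^ n) v, D.T v⟫_ℂ‖ ^ 2 := by rw [h1]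
    _ ≤ RCLike.re ⟪(D.T ^ n) v, v⟫_ℂ * RCLike.re ⟪(D.T ^ n) (D.T v), D.T v⟫_ℂ := hcs
    _ = RCLike.re ⟪v, (D.T ^ n) v⟫_ℂ * RCLike.re ⟪v, (D.T ^ (n + 2)) v⟫_ℂ := by rw [h2, h3]

omit [CompleteSpace H] in
/-- **The decay upgrade** (per vector, no density, no spectral theorem): if the diagonal correlator of `v` is
EVENTUALLY bounded by `K rⁿ` for SOME constant `K` (`0 < r`), then the one-step ratio bound
`re ⟪v, T^{n+1} v⟫ ≤ r · re ⟪v, Tⁿ v⟫` holds for EVERY `n`.  Proof: by log-convexity the ratios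
`⟪v,T^{n+1}v⟫/⟪v,Tⁿv⟫` are non-decreasing, so a ratio `ρ > r` at one `n` forces growth `≥ ρʲ` from there on,
contradicting the eventual bound `K r^{n+j}`.  (Spectrally: the spectral measure of `v` is supported in `[0, r]`.)
[cite: GlimmJaffe1987, §6.1 Thm. 6.1.3 (iii)] [cite: Seiler1982, Ch. 2] -/
theorem _root_.Literature.Probability.LatticeModels.TransferData.re_inner_pow_succ_le_mul_of_eventually
    (D : TransferData H) (v : H) {r K : ℝ} (hr : 0 < r)
    (h : ∀ᶠ n in atTop, RCLike.re ⟪v, (D.T ^ n) v⟫_ℂ ≤ K * r ^ n) (n : ℕ) :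
    RCLike.re ⟪v, (D.T ^ (n + 1)) v⟫_ℂ ≤ r * RCLike.re ⟪v, (D.T ^ n) v⟫_ℂ := by
  set f : ℕ → ℝ := fun n => RCLike.re ⟪v, (D.T ^ n) v⟫_ℂ with hf
  have hf0 : ∀ n, 0 ≤ f n := fun n => D.re_inner_pow_nonneg v n
  have hconv : ∀ n, f (n + 1) ^ 2 ≤ f n * f (n + 2) := fun n => D.re_inner_pow_succ_sq_le v n
  have h' : ∀ᶠ n in atTop, f n ≤ K * r ^ n := h
  change f (n + 1) ≤ r * f n
  by_contra hlt
  push Not at hlt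
  -- positivity of `f (n+1)` and `f n`
  have hn1 : 0 < f (n + 1) := lt_of_le_of_lt (mul_nonneg hr.le (hf0 n)) hlt
  have hn0 : 0 < f n := by
    rcases (hf0 n).eq_or_lt with h0 | h0
    · exfalso
      have hc := hconv n
      rw [← h0, zero_mul] at hc
      nlinarith
    · exact h0
  -- the ratio `ρ = f (n+1) / f n > r`
  set ρ : ℝ := f (n + 1) / f n with hρ
  have hρr : r < ρ := by rw [hρ, lt_div_iff₀ hn0]; linarith
  have hρ0 : 0 < ρ := hr.trans hρr
  -- growth from `n` on: `ρ^j f n ≤ f (n+j)` and the ratio stays `≥ ρ`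
  have hgrow : ∀ j : ℕ, ρ ^ j * f n ≤ f (n + j) ∧ ρ * f (n + j) ≤ f (n + j + 1) := by
    intro j
    induction j with
    | zero =>
      refine ⟨by simp, ?_⟩
      rw [add_zero, hρ, div_mul_cancel₀ _ hn0.ne']
    | succ j ih =>
      obtain ⟨ih1, ih2⟩ := ih
      have hpos : 0 < f (n + j) := lt_of_lt_of_le (mul_pos (pow_pos hρ0 j) hn0) ih1
      have hpos1 : 0 < f (n + j + 1) := lt_of_lt_of_le (mul_pos hρ0 hpos) ih2
      refine ⟨?_, ?_⟩
      · calc ρ ^ (j + 1) * f n = ρ * (ρ ^ j * f n) := by ring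
          _ ≤ ρ * f (n + j) := mul_le_mul_of_nonneg_left ih1 hρ0.le
          _ ≤ f (n + (j + 1)) := by rw [← add_assoc]; exact ih2
      · have hc := hconv (n + j)
        rw [show n + (j + 1) = n + j + 1 by ring]
        have key : ρ * f (n + j + 1) * f (n + j) ≤ f (n + j + 2) * f (n + j) := by
          calc ρ * f (n + j + 1) * f (n + j) = (ρ * f (n + j)) * f (n + j + 1) := by ring
            _ ≤ f (n + j + 1) * f (n + j + 1) := mul_le_mul_of_nonneg_right ih2 hpos1.le
            _ = f (n + j + 1) ^ 2 := by ring
            _ ≤ f (n + j) * f (n + j + 2) := hc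
            _ = f (n + j + 2) * f (n + j) := by ring
        exact le_of_mul_le_mul_right key hpos
  -- contradiction with the eventual bound
  obtain ⟨N, hN⟩ := eventually_atTop.mp h'
  have hs : 1 < ρ / r := (one_lt_div hr).mpr hρr
  obtain ⟨j, hj1, hj2⟩ := (((tendsto_pow_atTop_atTop_of_one_lt hs).eventually_gt_atTop
    (K * r ^ n / f n)).and (eventually_ge_atTop N)).exists
  have hle : f (n + j) ≤ K * r ^ (n + j) := hN (n + j) (le_add_left hj2)
  have hge : ρ ^ j * f n ≤ f (n + j) := (hgrow j).1
  have hcon : (ρ / r) ^ j ≤ K * r ^ n / f n := by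
    rw [div_pow, div_le_div_iff₀ (pow_pos hr j) hn0]
    calc ρ ^ j * f n ≤ f (n + j) := hge
      _ ≤ K * r ^ (n + j) := hle
      _ = K * r ^ n * r ^ j := by rw [pow_add]; ring
  linarith

omit [CompleteSpace H] in
/-- **Decay from any starting time with the honest constant**: under an eventual bound `re ⟪v, Tⁿ v⟫ ≤ K rⁿ`
(any `K`, `0 < r`), `re ⟪v, Tⁿ v⟫ ≤ re ⟪v, T^{n₀} v⟫ · r^{n − n₀}` for all `n ≥ n₀`.
[cite: GlimmJaffe1987, §6.1 Thm. 6.1.3 (iii)] -/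
theorem _root_.Literature.Probability.LatticeModels.TransferData.re_inner_pow_le_mul_pow_of_eventually
    (D : TransferData H) (v : H) {r K : ℝ} (hr : 0 < r)
    (h : ∀ᶠ n in atTop, RCLike.re ⟪v, (D.T ^ n) v⟫_ℂ ≤ K * r ^ n) {n₀ n : ℕ} (hn : n₀ ≤ n) :
    RCLike.re ⟪v, (D.T ^ n) v⟫_ℂ ≤ RCLike.re ⟪v, (D.T ^ n₀) v⟫_ℂ * r ^ (n - n₀) := by
  obtain ⟨j, rfl⟩ := Nat.exists_eq_add_of_le hn
  rw [Nat.add_sub_cancel_left]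
  clear hn
  induction j with
  | zero => simp
  | succ j ih =>
    calc RCLike.re ⟪v, (D.T ^ (n₀ + (j + 1))) v⟫_ℂ = RCLike.re ⟪v, (D.T ^ (n₀ + j + 1)) v⟫_ℂ := by
          rw [add_assoc]
      _ ≤ r * RCLike.re ⟪v, (D.T ^ (n₀ + j)) v⟫_ℂ := D.re_inner_pow_succ_le_mul_of_eventually v hr h _
      _ ≤ r * (RCLike.re ⟪v, (D.T ^ n₀) v⟫_ℂ * r ^ j) := mul_le_mul_of_nonneg_left ih hr.le
      _ = RCLike.re ⟪v, (D.T ^ n₀) v⟫_ℂ * r ^ (j + 1) := by ring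

omit [CompleteSpace H] in
/-- **Decay from time zero with the constant `‖v‖²`**: under an eventual bound `re ⟪v, Tⁿ v⟫ ≤ K rⁿ` (any `K`,
`0 < r`), `re ⟪v, Tⁿ v⟫ ≤ ‖v‖² rⁿ` for every `n` — the spectral measure of `v` lives in `[0, r]`.
[cite: GlimmJaffe1987, §6.1 Thm. 6.1.3 (iii)] -/
theorem _root_.Literature.Probability.LatticeModels.TransferData.re_inner_pow_le_norm_sq_mul_pow_of_eventually
    (D : TransferData H) (v : H) {r K : ℝ} (hr : 0 < r)
    (h : ∀ᶠ n in atTop, RCLike.re ⟪v, (D.T ^ n) v⟫_ℂ ≤ K * r ^ n) (n : ℕ) :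
    RCLike.re ⟪v, (D.T ^ n) v⟫_ℂ ≤ ‖v‖ ^ 2 * r ^ n := by
  have h0 : RCLike.re ⟪v, (D.T ^ 0) v⟫_ℂ = ‖v‖ ^ 2 := by
    rw [pow_zero, one_apply_eq_self, inner_self_eq_norm_sq]
  have := D.re_inner_pow_le_mul_pow_of_eventually v hr h (Nat.zero_le n)
  rwa [h0, Nat.sub_zero] at this

/-! ### Connected (vacuum-truncated) diagonal correlators -/

omit [CompleteSpace H] in
/-- The connected diagonal correlator is dominated by the norm form in which clustering is usually stated:
`re ⟪v, Tⁿ v⟫ − ‖⟪Ω, v⟫‖² ≤ ‖⟪v, Tⁿ v⟫ − ⟪v, Ω⟫⟪Ω, v⟫‖`. [folklore] -/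
theorem _root_.Literature.Probability.LatticeModels.TransferData.re_inner_pow_sub_le_norm_sub (D : TransferData H)
    (v : H) (n : ℕ) :
    RCLike.re ⟪v, (D.T ^ n) v⟫_ℂ - ‖⟪D.vacuum, v⟫_ℂ‖ ^ 2 ≤
      ‖⟪v, (D.T ^ n) v⟫_ℂ - ⟪v, D.vacuum⟫_ℂ * ⟪D.vacuum, v⟫_ℂ‖ := by
  have h := RCLike.re_le_norm (⟪v, (D.T ^ n) v⟫_ℂ - ⟪v, D.vacuum⟫_ℂ * ⟪D.vacuum, v⟫_ℂ)
  rwa [map_sub, D.re_inner_vacuum_mul_self] at h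

/-- An eventual norm-form clustering bound for the diagonal pair `(v, v)` is an eventual bound for the connected
diagonal correlator of the projected vector `P_{Ω^⊥} v`. [folklore] -/
theorem _root_.Literature.Probability.LatticeModels.TransferData.eventually_re_inner_pow_proj_le
    (D : TransferData H) (v : H) {r K : ℝ}
    (h : ∀ᶠ n in atTop, ‖⟪v, (D.T ^ n) v⟫_ℂ - ⟪v, D.vacuum⟫_ℂ * ⟪D.vacuum, v⟫_ℂ‖ ≤ K * r ^ n) :
    ∀ᶠ n in atTop, RCLike.re ⟪(D.vacuumLine)ᗮ.starProjection v,
      (D.T ^ n) ((D.vacuumLine)ᗮ.starProjection v)⟫_ℂ ≤ K * r ^ n :=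
  h.mono fun n hn => by
    rw [← D.re_inner_pow_sub_eq]
    exact (D.re_inner_pow_sub_le_norm_sub v n).trans hn

/-- **Decay upgrade, connected form**: if `‖⟪v, Tⁿ v⟫ − ⟪v, Ω⟫⟪Ω, v⟫‖ ≤ K rⁿ` eventually (any `K`, `0 < r`), then
`re ⟪v, T^{n+1} v⟫ − ‖⟪Ω, v⟫‖² ≤ r · (re ⟪v, Tⁿ v⟫ − ‖⟪Ω, v⟫‖²)` for every `n`.
[cite: GlimmJaffe1987, §6.1 Thm. 6.1.3 (iii)] -/
theorem _root_.Literature.Probability.LatticeModels.TransferData.re_inner_pow_sub_succ_le_mul_of_eventually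
    (D : TransferData H) (v : H) {r K : ℝ} (hr : 0 < r)
    (h : ∀ᶠ n in atTop, ‖⟪v, (D.T ^ n) v⟫_ℂ - ⟪v, D.vacuum⟫_ℂ * ⟪D.vacuum, v⟫_ℂ‖ ≤ K * r ^ n) (n : ℕ) :
    RCLike.re ⟪v, (D.T ^ (n + 1)) v⟫_ℂ - ‖⟪D.vacuum, v⟫_ℂ‖ ^ 2 ≤
      r * (RCLike.re ⟪v, (D.T ^ n) v⟫_ℂ - ‖⟪D.vacuum, v⟫_ℂ‖ ^ 2) := by
  rw [D.re_inner_pow_sub_eq, D.re_inner_pow_sub_eq]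
  exact D.re_inner_pow_succ_le_mul_of_eventually _ hr (D.eventually_re_inner_pow_proj_le v h) n

/-- **Connected decay from any starting time with the honest constant**: under the eventual norm-form bound,
`re ⟪v, Tⁿ v⟫ − ‖⟪Ω, v⟫‖² ≤ (re ⟪v, T^{n₀} v⟫ − ‖⟪Ω, v⟫‖²) · r^{n − n₀}` for all `n ≥ n₀`.
[cite: GlimmJaffe1987, §6.1 Thm. 6.1.3 (iii)] -/
theorem _root_.Literature.Probability.LatticeModels.TransferData.re_inner_pow_sub_le_mul_pow_of_eventually
    (D : TransferData H) (v : H) {r K : ℝ} (hr : 0 < r)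
    (h : ∀ᶠ n in atTop, ‖⟪v, (D.T ^ n) v⟫_ℂ - ⟪v, D.vacuum⟫_ℂ * ⟪D.vacuum, v⟫_ℂ‖ ≤ K * r ^ n)
    {n₀ n : ℕ} (hn : n₀ ≤ n) :
    RCLike.re ⟪v, (D.T ^ n) v⟫_ℂ - ‖⟪D.vacuum, v⟫_ℂ‖ ^ 2 ≤
      (RCLike.re ⟪v, (D.T ^ n₀) v⟫_ℂ - ‖⟪D.vacuum, v⟫_ℂ‖ ^ 2) * r ^ (n - n₀) := by
  rw [D.re_inner_pow_sub_eq, D.re_inner_pow_sub_eq]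
  exact D.re_inner_pow_le_mul_pow_of_eventually _ hr (D.eventually_re_inner_pow_proj_le v h) hn

/-- **Connected decay from time zero with the truncated norm**: under the eventual norm-form bound,
`re ⟪v, Tⁿ v⟫ − ‖⟪Ω, v⟫‖² ≤ (‖v‖² − ‖⟪Ω, v⟫‖²) · rⁿ` for every `n`. [cite: GlimmJaffe1987, §6.1 Thm. 6.1.3 (iii)] -/
theorem _root_.Literature.Probability.LatticeModels.TransferData.re_inner_pow_sub_le_truncNorm_mul_pow_of_eventually
    (D : TransferData H) (v : H) {r K : ℝ} (hr : 0 < r)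
    (h : ∀ᶠ n in atTop, ‖⟪v, (D.T ^ n) v⟫_ℂ - ⟪v, D.vacuum⟫_ℂ * ⟪D.vacuum, v⟫_ℂ‖ ≤ K * r ^ n) (n : ℕ) :
    RCLike.re ⟪v, (D.T ^ n) v⟫_ℂ - ‖⟪D.vacuum, v⟫_ℂ‖ ^ 2 ≤ (‖v‖ ^ 2 - ‖⟪D.vacuum, v⟫_ℂ‖ ^ 2) * r ^ n := by
  rw [D.re_inner_pow_sub_eq, ← D.norm_proj_sq_eq]
  exact D.re_inner_pow_le_norm_sq_mul_pow_of_eventually _ hr (D.eventually_re_inner_pow_proj_le v h) n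

/-- **Norm decay of the projected orbit from any starting time**: under the eventual norm-form bound for the
diagonal pair `(v, v)`, `‖Tᵃ P_{Ω^⊥} v‖ ≤ √(re ⟪v, T^{2a₀} v⟫ − ‖⟪Ω, v⟫‖²) · r^{a − a₀}` for all `a ≥ a₀`.
[cite: GlimmJaffe1987, §6.1 Thm. 6.1.3 (iii)] -/
theorem _root_.Literature.Probability.LatticeModels.TransferData.norm_pow_proj_le_of_eventually
    (D : TransferData H) (v : H) {r K : ℝ} (hr : 0 < r)
    (h : ∀ᶠ n in atTop, ‖⟪v, (D.T ^ n) v⟫_ℂ - ⟪v, D.vacuum⟫_ℂ * ⟪D.vacuum, v⟫_ℂ‖ ≤ K * r ^ n)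
    {a₀ a : ℕ} (ha : a₀ ≤ a) :
    ‖(D.T ^ a) ((D.vacuumLine)ᗮ.starProjection v)‖ ≤
      Real.sqrt (RCLike.re ⟪v, (D.T ^ (2 * a₀)) v⟫_ℂ - ‖⟪D.vacuum, v⟫_ℂ‖ ^ 2) * r ^ (a - a₀) := by
  set w := (D.vacuumLine)ᗮ.starProjection v with hw
  have hsq : ‖(D.T ^ a) w‖ ^ 2 ≤
      (RCLike.re ⟪v, (D.T ^ (2 * a₀)) v⟫_ℂ - ‖⟪D.vacuum, v⟫_ℂ‖ ^ 2) * (r ^ (a - a₀)) ^ 2 := by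
    rw [D.norm_pow_apply_sq, D.re_inner_pow_sub_eq, ← pow_mul, show (a - a₀) * 2 = 2 * a - 2 * a₀ by omega]
    exact D.re_inner_pow_le_mul_pow_of_eventually w hr (D.eventually_re_inner_pow_proj_le v h) (by omega)
  have hA : 0 ≤ RCLike.re ⟪v, (D.T ^ (2 * a₀)) v⟫_ℂ - ‖⟪D.vacuum, v⟫_ℂ‖ ^ 2 := by
    rw [D.re_inner_pow_sub_eq]; exact D.re_inner_pow_nonneg _ _
  calc ‖(D.T ^ a) w‖ = Real.sqrt (‖(D.T ^ a) w‖ ^ 2) := (Real.sqrt_sq (norm_nonneg _)).symm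
    _ ≤ Real.sqrt ((RCLike.re ⟪v, (D.T ^ (2 * a₀)) v⟫_ℂ - ‖⟪D.vacuum, v⟫_ℂ‖ ^ 2) * (r ^ (a - a₀)) ^ 2) :=
        Real.sqrt_le_sqrt hsq
    _ = Real.sqrt (RCLike.re ⟪v, (D.T ^ (2 * a₀)) v⟫_ℂ - ‖⟪D.vacuum, v⟫_ℂ‖ ^ 2) * r ^ (a - a₀) := by
        rw [Real.sqrt_mul hA, Real.sqrt_sq (pow_nonneg hr.le _)]

/-! ### Mixed correlators: full rate from two eventual diagonal bounds -/

/-- **Full-rate mixed clustering from two eventual diagonal bounds, from any pair of starting times**: if the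
diagonal pairs `(u, u)` and `(v, v)` cluster eventually at rate `r` with ANY constants, then for all `n ≥ a₀ + b₀`
`‖⟪u, Tⁿ v⟫ − ⟪u, Ω⟫⟪Ω, v⟫‖ ≤ √(re ⟪u, T^{2a₀} u⟫ − ‖⟪Ω,u⟫‖²) · √(re ⟪v, T^{2b₀} v⟫ − ‖⟪Ω,v⟫‖²) · r^{n−(a₀+b₀)}`:
split `Tⁿ = Tᵃ⁰ T^{n−a₀}`, move `Tᵃ⁰` to the left (symmetry) and use the projected orbit decay on both sides.
[cite: GlimmJaffe1987, §6.1 Thm. 6.1.3 (ii)–(iii)] [cite: Seiler1982, Ch. 2] -/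
theorem _root_.Literature.Probability.LatticeModels.TransferData.norm_inner_pow_sub_le_of_eventually
    (D : TransferData H) {u v : H} {r Ku Kv : ℝ} (hr : 0 < r)
    (hu : ∀ᶠ n in atTop, ‖⟪u, (D.T ^ n) u⟫_ℂ - ⟪u, D.vacuum⟫_ℂ * ⟪D.vacuum, u⟫_ℂ‖ ≤ Ku * r ^ n)
    (hv : ∀ᶠ n in atTop, ‖⟪v, (D.T ^ n) v⟫_ℂ - ⟪v, D.vacuum⟫_ℂ * ⟪D.vacuum, v⟫_ℂ‖ ≤ Kv * r ^ n)
    {a₀ b₀ n : ℕ} (hn : a₀ + b₀ ≤ n) :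
    ‖⟪u, (D.T ^ n) v⟫_ℂ - ⟪u, D.vacuum⟫_ℂ * ⟪D.vacuum, v⟫_ℂ‖ ≤
      Real.sqrt (RCLike.re ⟪u, (D.T ^ (2 * a₀)) u⟫_ℂ - ‖⟪D.vacuum, u⟫_ℂ‖ ^ 2) *
        Real.sqrt (RCLike.re ⟪v, (D.T ^ (2 * b₀)) v⟫_ℂ - ‖⟪D.vacuum, v⟫_ℂ‖ ^ 2) * r ^ (n - (a₀ + b₀)) := by
  set P := (D.vacuumLine)ᗮ.starProjection with hP
  have hsplit : (D.T ^ n) (P v) = (D.T ^ a₀) ((D.T ^ (n - a₀)) (P v)) := by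
    rw [← mul_apply_eq_comp (D.T ^ a₀), ← pow_add, Nat.add_sub_cancel' (by omega : a₀ ≤ n)]
  rw [D.inner_pow_sub_eq u v n, hsplit, ← D.inner_pow_apply_left]
  have h1 := D.norm_pow_proj_le_of_eventually u hr hu (le_refl a₀)
  have h2 := D.norm_pow_proj_le_of_eventually v hr hv (show b₀ ≤ n - a₀ by omega)
  rw [Nat.sub_self, pow_zero, mul_one] at h1
  rw [show n - a₀ - b₀ = n - (a₀ + b₀) by omega] at h2
  calc ‖⟪(D.T ^ a₀) (P u), (D.T ^ (n - a₀)) (P v)⟫_ℂ‖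
      ≤ ‖(D.T ^ a₀) (P u)‖ * ‖(D.T ^ (n - a₀)) (P v)‖ := norm_inner_le_norm _ _
    _ ≤ Real.sqrt (RCLike.re ⟪u, (D.T ^ (2 * a₀)) u⟫_ℂ - ‖⟪D.vacuum, u⟫_ℂ‖ ^ 2) *
        (Real.sqrt (RCLike.re ⟪v, (D.T ^ (2 * b₀)) v⟫_ℂ - ‖⟪D.vacuum, v⟫_ℂ‖ ^ 2) * r ^ (n - (a₀ + b₀))) :=
        mul_le_mul h1 h2 (norm_nonneg _) (Real.sqrt_nonneg _)
    _ = _ := by ring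

/-- **Full-rate mixed clustering from two eventual diagonal bounds, from time zero**: with the truncated norms as
constants, `‖⟪u, Tⁿ v⟫ − ⟪u, Ω⟫⟪Ω, v⟫‖ ≤ √(‖u‖² − ‖⟪Ω,u⟫‖²) · √(‖v‖² − ‖⟪Ω,v⟫‖²) · rⁿ` for every `n` — the
constants and thresholds of the two diagonal hypotheses have disappeared. [cite: GlimmJaffe1987, §6.1 Thm. 6.1.3] -/
theorem _root_.Literature.Probability.LatticeModels.TransferData.norm_inner_pow_sub_le_truncNorm_of_eventually
    (D : TransferData H) {u v : H} {r Ku Kv : ℝ} (hr : 0 < r)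
    (hu : ∀ᶠ n in atTop, ‖⟪u, (D.T ^ n) u⟫_ℂ - ⟪u, D.vacuum⟫_ℂ * ⟪D.vacuum, u⟫_ℂ‖ ≤ Ku * r ^ n)
    (hv : ∀ᶠ n in atTop, ‖⟪v, (D.T ^ n) v⟫_ℂ - ⟪v, D.vacuum⟫_ℂ * ⟪D.vacuum, v⟫_ℂ‖ ≤ Kv * r ^ n) (n : ℕ) :
    ‖⟪u, (D.T ^ n) v⟫_ℂ - ⟪u, D.vacuum⟫_ℂ * ⟪D.vacuum, v⟫_ℂ‖ ≤
      Real.sqrt (‖u‖ ^ 2 - ‖⟪D.vacuum, u⟫_ℂ‖ ^ 2) * Real.sqrt (‖v‖ ^ 2 - ‖⟪D.vacuum, v⟫_ℂ‖ ^ 2) * r ^ n := by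
  have h := D.norm_inner_pow_sub_le_of_eventually hr hu hv (show 0 + 0 ≤ n by omega)
  have hu0 : RCLike.re ⟪u, (D.T ^ (2 * 0)) u⟫_ℂ = ‖u‖ ^ 2 := by
    rw [mul_zero, pow_zero, one_apply_eq_self, inner_self_eq_norm_sq]
  have hv0 : RCLike.re ⟪v, (D.T ^ (2 * 0)) v⟫_ℂ = ‖v‖ ^ 2 := by
    rw [mul_zero, pow_zero, one_apply_eq_self, inner_self_eq_norm_sq]
  rwa [hu0, hv0, add_zero, Nat.sub_zero] at h

end Transfer

/-! ### The same for an Osterwalder–Schrader realisation of a measure -/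

section OS

variable {Ω : Type*} {mΩ : MeasurableSpace Ω}
variable {H : Type*} [NormedAddCommGroup H] [InnerProductSpace ℂ H] [CompleteSpace H]
variable {μ : Measure Ω} {reflect shift : Ω → Ω} {mpos : MeasurableSpace Ω} {ι : (Ω → ℂ) → H}
  {D : TransferData H}

/-- **Decay upgrade for a reflection-positive measure, diagonal form**: if the reflected connected correlator of ONE
bounded positive-time observable `F` clusters EVENTUALLY, `|⟨θF̄ · F∘shiftᵗ⟩ − ⟨θF̄⟩⟨F⟩| ≤ K e^{−mt}` for `t ≥ t₁`
with SOME constant `K`, then for all `t ≥ t₀` (any `t₀`)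
`Re⟨θF̄ · F∘shiftᵗ⟩ − |⟨F⟩|² ≤ (Re⟨θF̄ · F∘shift^{t₀}⟩ − |⟨F⟩|²) · e^{−m(t−t₀)}`: the constant is the connected
diagonal correlator at the chosen starting time, the threshold is gone. [cite: GlimmJaffe1987, §6.1 Thm. 6.1.3]
[cite: OsterwalderSeiler1978, §2] -/
theorem _root_.Literature.Probability.LatticeModels.IsOSRealisation.re_truncated_le_of_eventually
    (hOS : IsOSRealisation (mΩ := mΩ) μ reflect shift mpos ι D) {F : Ω → ℂ}
    (hF : IsBoundedMeasurable mpos F) {m K : ℝ}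
    (h : ∀ᶠ t : ℕ in atTop, ‖(∫ ω, starRingEnd ℂ (F (reflect ω)) * F (shift^[t] ω) ∂μ) -
        (∫ ω, starRingEnd ℂ (F (reflect ω)) ∂μ) * ∫ ω, F ω ∂μ‖ ≤ K * Real.exp (-m * t))
    {t₀ t : ℕ} (ht : t₀ ≤ t) :
    RCLike.re (∫ ω, starRingEnd ℂ (F (reflect ω)) * F (shift^[t] ω) ∂μ) - ‖∫ ω, F ω ∂μ‖ ^ 2 ≤
      (RCLike.re (∫ ω, starRingEnd ℂ (F (reflect ω)) * F (shift^[t₀] ω) ∂μ) - ‖∫ ω, F ω ∂μ‖ ^ 2) *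
        Real.exp (-m) ^ (t - t₀) := by
  rw [hOS.integral_conj_comp_reflect_mul_comp_iterate hF hF t,
    hOS.integral_conj_comp_reflect_mul_comp_iterate hF hF t₀, hOS.integral_eq_inner_vacuum hF]
  refine D.re_inner_pow_sub_le_mul_pow_of_eventually (ι F) (Real.exp_pos _) (K := K) ?_ ht
  refine h.mono fun s hs => ?_
  rw [hOS.integral_conj_comp_reflect_mul_comp_iterate hF hF s, hOS.integral_conj_comp_reflect hF,
    hOS.integral_eq_inner_vacuum hF] at hs
  rwa [← Real.exp_nat_mul, mul_comm (s : ℝ)]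

/-- **Decay upgrade for a reflection-positive measure, mixed form**: if the reflected connected DIAGONAL correlators
of two bounded positive-time observables `F`, `G` each cluster eventually at rate `m` with their own constants and
thresholds, then for EVERY `t`
`|⟨θF̄ · G∘shiftᵗ⟩ − ⟨θF̄⟩⟨G⟩| ≤ √(Re⟨θF̄·F⟩ − |⟨F⟩|²) · √(Re⟨θḠ·G⟩ − |⟨G⟩|²) · e^{−mt}` — full rate, threshold
zero, constants the truncated reflected norms. [cite: GlimmJaffe1987, §6.1 Thm. 6.1.3] [cite: Seiler1982, Ch. 2] -/
theorem _root_.Literature.Probability.LatticeModels.IsOSRealisation.norm_truncated_le_of_eventually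
    (hOS : IsOSRealisation (mΩ := mΩ) μ reflect shift mpos ι D) {F G : Ω → ℂ}
    (hF : IsBoundedMeasurable mpos F) (hG : IsBoundedMeasurable mpos G) {m KF KG : ℝ}
    (hFe : ∀ᶠ t : ℕ in atTop, ‖(∫ ω, starRingEnd ℂ (F (reflect ω)) * F (shift^[t] ω) ∂μ) -
        (∫ ω, starRingEnd ℂ (F (reflect ω)) ∂μ) * ∫ ω, F ω ∂μ‖ ≤ KF * Real.exp (-m * t))
    (hGe : ∀ᶠ t : ℕ in atTop, ‖(∫ ω, starRingEnd ℂ (G (reflect ω)) * G (shift^[t] ω) ∂μ) -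
        (∫ ω, starRingEnd ℂ (G (reflect ω)) ∂μ) * ∫ ω, G ω ∂μ‖ ≤ KG * Real.exp (-m * t)) (t : ℕ) :
    ‖(∫ ω, starRingEnd ℂ (F (reflect ω)) * G (shift^[t] ω) ∂μ) -
        (∫ ω, starRingEnd ℂ (F (reflect ω)) ∂μ) * ∫ ω, G ω ∂μ‖ ≤
      Real.sqrt (RCLike.re (∫ ω, starRingEnd ℂ (F (reflect ω)) * F ω ∂μ) - ‖∫ ω, F ω ∂μ‖ ^ 2) *
        Real.sqrt (RCLike.re (∫ ω, starRingEnd ℂ (G (reflect ω)) * G ω ∂μ) - ‖∫ ω, G ω ∂μ‖ ^ 2) *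
          Real.exp (-m * t) := by
  have conv : ∀ {X : Ω → ℂ} (_ : IsBoundedMeasurable mpos X) {KX : ℝ},
      (∀ᶠ s : ℕ in atTop, ‖(∫ ω, starRingEnd ℂ (X (reflect ω)) * X (shift^[s] ω) ∂μ) -
        (∫ ω, starRingEnd ℂ (X (reflect ω)) ∂μ) * ∫ ω, X ω ∂μ‖ ≤ KX * Real.exp (-m * s)) →
      ∀ᶠ s : ℕ in atTop, ‖⟪ι X, (D.T ^ s) (ι X)⟫_ℂ - ⟪ι X, D.vacuum⟫_ℂ * ⟪D.vacuum, ι X⟫_ℂ‖ ≤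
        KX * Real.exp (-m) ^ s := by
    intro X hX KX hX'
    refine hX'.mono fun s hs => ?_
    rw [hOS.integral_conj_comp_reflect_mul_comp_iterate hX hX s, hOS.integral_conj_comp_reflect hX,
      hOS.integral_eq_inner_vacuum hX] at hs
    rwa [← Real.exp_nat_mul, mul_comm (s : ℝ)]
  rw [hOS.integral_conj_comp_reflect_mul_comp_iterate hF hG t, hOS.integral_conj_comp_reflect hF,
    hOS.integral_eq_inner_vacuum hG, hOS.integral_eq_inner_vacuum hF,
    hOS.re_integral_conj_comp_reflect_mul_self hF, hOS.re_integral_conj_comp_reflect_mul_self hG]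
  have h := D.norm_inner_pow_sub_le_truncNorm_of_eventually (Real.exp_pos _) (conv hF hFe) (conv hG hGe) t
  rwa [← Real.exp_nat_mul, mul_comm (t : ℝ)] at h

end OS

end Literature.MathematicalPhysics.QuantumFieldTheory
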